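import Summits.CriticalPhenomena.SAWScalingLimit.Theses.SAWRenewalTightness
import Summits.CriticalPhenomena.SAWScalingLimit.Theorems.SAWRenewalTightnessTightOfShellCrossing
import Summits.CriticalPhenomena.SAWScalingLimit.Theorems.ShellCrossingBound.Negative.OfEventualTight
import Summits.CriticalPhenomena.SAWScalingLimit.Theorems.SAWRenewalTightnessEventualTightSketchDefs

/-!
# `ShellCrossingBound` is the route target `EventualTight` under another name

Crux item stmt-CriticalPhenomena-4728 (`SAWRenewalTightness.ShellCrossingBound`, rank 2 of route
`route-CriticalPhenomena-SAWRenewalTightness`) and the route's target stmt-CriticalPhenomena-1372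
(`SAWRenewalTightness.EventualTight`, rank 0) are EQUIVALENT statements, unconditionally, by two
files already in the tree:

* `⇒` is the support item stmt-CriticalPhenomena-4732 `TightOfShellCrossing`, PROVED
  (`Theorems.TightOfShellCrossing_proof`: the Aizenman–Burchard criterion
  `isTightMeasureSet_of_traversalBounds` applied to the SAW polylines);
* `⇐` is `Theorems.ShellCrossingBound.Negative.not_eventualTight_of_not_shellCrossingBound` (p72603,
  cdisprove cycle 1), stated there in refuter-admissible negative form: because the traversal
  threshold `k x ρ R` of the crux is chosen PER SHELL after `(D, a, b)`, tightness gives for every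
  genuine shell a compact set of curve classes carrying all but `(ρ/R)^3` of every law, on which the
  number of separate traversals is bounded.

This file only PACKAGES the equivalence as one importable, citable `Iff` (registered obligation
`shellCrossingBound_iff_eventualTight` on the crux item), together with the composite through the
sibling line's no-exponent criterion `ShellCountTight` (`Theorems.shellCountTight_iff_eventualTight`,
crux stmt-CriticalPhenomena-1372, line `Sketch`).  Nothing here credits either crux: both sides
stay open.  Consequence recorded for the planner (lead seat c3-0 of the crux, 2026-08-16): as typed
the crux carries no content beyond the target — every line for it is a proof of eventual tightness
of the critical `ℤ²` SAW, and it closes by a three-line file the moment stmt-1372 lands; the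
content-bearing residue is the registered fixed-threshold statement `stub_pinchAway` (S0, line
`pinch-on-a-circle`) resp. `ShellCrossingBoundBulkAt 4` (Cruxes/…/Disproof.lean §5).
Sources: M. Aizenman, A. Burchard, *Hölder regularity and dimension bounds for random curves*,
Duke Math. J. 99 (1999), Thm 1.1 / §2 (the criterion) [AizenmanBurchardDuke1999]; the converse is
folklore (compact families of curve classes have bounded traversal counts of a genuine shell).
-/

namespace Summit.CriticalPhenomena.SAWScalingLimit.Theorems

open Summit.CriticalPhenomena.SAWScalingLimit.Theses.SAWRenewalTightness
open Literature.Probability.RandomPlanarGeometry Literature.Probability.LatticeModels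

/-- **The crux is the target.** `ShellCrossingBound ↔ EventualTight`: the Aizenman–Burchard
shell-crossing bound with a shell-dependent threshold for the critical `ℤ²` SAW laws holds iff the
pushed-forward laws are eventually tight.  `⇒`: the proved support item `TightOfShellCrossing`
(AB criterion); `⇐`: the landed negative lemma `not_eventualTight_of_not_shellCrossingBound`
(tightness ⇒ per-shell bounded traversal counts on compacts ⇒ any shell-dependent target, here
`K = 1`, `λ = 3`). [cite: AizenmanBurchardDuke1999, Thm 1.1 and §2] -/
theorem shellCrossingBound_iff_eventualTight :
    Summit.CriticalPhenomena.SAWScalingLimit.Theses.SAWRenewalTightness.ShellCrossingBound ↔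
    Summit.CriticalPhenomena.SAWScalingLimit.Theses.SAWRenewalTightness.EventualTight :=
  ⟨TightOfShellCrossing_proof, fun hT => Classical.byContradiction fun h =>
    ShellCrossingBound.Negative.not_eventualTight_of_not_shellCrossingBound h hT⟩

/-- **The crux is the no-exponent criterion.** `ShellCrossingBound` holds iff for every Dobrushin
domain and endpoint approximation there is `δ₀ > 0` such that for every fixed genuine shell
`D(x; ρ, R)` and every `η > 0` some threshold `k` makes `P_δ[k separate traversals] ≤ η` for all
`δ ∈ (0, δ₀]` (`ShellCountTight` of the sibling crux's line `Sketch`, unfolded) — the composite of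
`shellCrossingBound_iff_eventualTight` with the landed `shellCountTight_iff_eventualTight`.  So the
power law `K (ρ/R)^λ`, `λ > 2`, the mesh clause `δ ≤ ρ` and `R ≤ 1` of the crux are all decorative.
[cite: AizenmanBurchardDuke1999, Thm 1.1 and §2] -/
theorem shellCrossingBound_iff_shellCountTight :
    Summit.CriticalPhenomena.SAWScalingLimit.Theses.SAWRenewalTightness.ShellCrossingBound ↔
    (∀ (D : DobrushinDomain) (a b : ℝ → Site 2), SAW.IsEndpointApprox D a b →
      ∃ δ₀ : ℝ, 0 < δ₀ ∧ ∀ (x : ℂ) (ρ R : ℝ), 0 < ρ → ρ < R → ∀ η : ℝ, 0 < η →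
        ∃ k : ℕ, ∀ δ ∈ Set.Ioc (0 : ℝ) δ₀,
          SAW.law D.carrier δ (a δ) (b δ)
            {γ | (⟨γ.walk.toCurve (meshPoint δ)⟩ : Curve ℂ).HasTraversals k x ρ R}
            ≤ ENNReal.ofReal η) :=
  shellCrossingBound_iff_eventualTight.trans shellCountTight_iff_eventualTight.symm

end Summit.CriticalPhenomena.SAWScalingLimit.Theorems
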